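import Literature.Probability.LatticeModels.CollarLegModel

/-!
# `CollarLegModel`: the sanity values `Z(1×1) = 1` and `Z(2×1) = 2`

The two checks asked for by the definition request `defn-CollarLegModel` (SPEC §C), for the
closed collar `CollarLegModel.ofDomain V` of `Literature/Probability/LatticeModels/CollarLegModel.lean`:

* `Z_1x1` — one vertex, no live edge, four exterior edges: the two configurations `h = ±1` weigh
  `e^{±4iμ} = e^{±iπ/3}` (`μ = π/12`), so `Z = e^{iπ/3} + e^{-iπ/3} = 2cos(π/3) = 1 = 2^{|E|}`;
* `Z_2x1` — two vertices, one live edge, six exterior edges: the four configurations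
  `(h₀, h₁) ∈ {±1}²`; the two c-type ones (`h₀ = h₁`, both faces of the edge being collar faces at
  `0`) weigh `√3 e^{±6iμ} = ±i√3` and cancel, the two others weigh `e^{3iμ} e^{-3iμ} = 1`:
  `Z = 2 = 2^{|E|}`.

Both are instances of `Z = 2^{|E|}` for the closed collar (BKW at `q = 1`: loop weight
`e^{iπ/3} + e^{-iπ/3} = 1`), verified by enumeration on nine domains in the definition seat and to
be proved in general where needed. On the way: the algebra of the turn phase
`phase k = e^{iμk}` (`phase_mul_phase`, `phase_pow`, `phase_six = i`, …).

Proof pattern (reusable for other explicit domains): compute the cell/edge finsets by `decide`,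
make the model opaque (`generalize`), identify configurations with their values on the free cells
(`Finset.sum_nbij'`), and evaluate the finitely many weights.

## References

* R. J. Baxter, S. B. Kelland, F. Y. Wu, J. Phys. A 9 (1976) 397–406. [BaxterKellandWu1976]
* H. Duminil-Copin, K. K. Kozlowski, P. Lammers, I. Manolescu, arXiv:2603.06268 (2026), §3.2
  (`2πμ = arccos(√q/2) = π/3` at `q = 1`). [DKLM2026SixVertexGFF]
-/

namespace Literature.Probability.LatticeModels.CollarLegModel

section Sanity

/-- `e^{iπ/3} + e^{-iπ/3} = 2cos(π/3) = 1`: the loop weight of the BKW coupling at `q = 1`. [cite: DKLM2026SixVertexGFF, §3.2] -/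
theorem phase_one_pow_four_add : phase 1 ^ 4 + phase (-1) ^ 4 = 1 := by
  have h1 : phase 1 ^ 4 = Complex.exp (((Real.pi / 3 : ℝ) : ℂ) * Complex.I) := by
    simp only [phase]
    rw [← Complex.exp_nat_mul]
    congr 1
    push_cast
    ring
  have h2 : phase (-1) ^ 4 = Complex.exp (-((Real.pi / 3 : ℝ) : ℂ) * Complex.I) := by
    simp only [phase]
    rw [← Complex.exp_nat_mul]
    congr 1
    push_cast
    ring
  rw [h1, h2, ← Complex.two_cos, ← Complex.ofReal_cos, Real.cos_pi_div_three]
  push_cast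
  ring

/-- **Sanity check `Z(1×1) = 1`**: the one-vertex domain has two configurations `h = ±1`, four
exterior edges each contributing `e^{iπh/12}`: `Z = e^{iπ/3} + e^{-iπ/3} = 1 = 2^{|E|}`. [folklore] -/
theorem Z_1x1 : (ofDomain {((0 : ℤ), (0 : ℤ))}).Z = 1 := by
  have hfree : (ofDomain {((0 : ℤ), (0 : ℤ))}).freeCells = {(((0 : ℤ), (0 : ℤ)), false)} := by decide
  have hE : (ofDomain {((0 : ℤ), (0 : ℤ))}).E = ∅ := by decide
  have hfr : (ofDomain {((0 : ℤ), (0 : ℤ))}).frozenEdges =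
      {(((0 : ℤ), (0 : ℤ)), false), (((0 : ℤ), (0 : ℤ)), true), (((-1 : ℤ), (0 : ℤ)), false),
        (((0 : ℤ), (-1 : ℤ)), true)} := by decide
  have hopen : (ofDomain {((0 : ℤ), (0 : ℤ))}).openEdges = ∅ := by decide
  have hV : (ofDomain {((0 : ℤ), (0 : ℤ))}).vertexCells = {((0 : ℤ), (0 : ℤ))} := by decide
  have hF : (ofDomain {((0 : ℤ), (0 : ℤ))}).faceCells =
      {((0 : ℤ), (0 : ℤ)), (-1, 0), (0, -1), (-1, -1)} := by decide
  have hB : 2 ≤ (ofDomain {((0 : ℤ), (0 : ℤ))}).bound := by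
    unfold bound; exact Nat.le_add_left _ _
  generalize hM : ofDomain {((0 : ℤ), (0 : ℤ))} = M at hfree hE hfr hopen hV hF hB ⊢
  have hc₀ : (((0 : ℤ), (0 : ℤ)), false) ∈ M.freeCells := by
    rw [hfree]; exact Finset.mem_singleton_self _
  set c₀ : ↥M.freeCells := ⟨_, hc₀⟩ with hc₀def
  have hsub : ∀ c : ↥M.freeCells, c = c₀ := fun c => by
    have h2 : (c : (ℤ × ℤ) × Bool) ∈ ({(((0 : ℤ), (0 : ℤ)), false)} : Finset ((ℤ × ℤ) × Bool)) :=
      hfree ▸ c.2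
    apply Subtype.ext
    rw [hc₀def]
    exact Finset.mem_singleton.mp h2
  have hhv : ∀ h : ↥M.freeCells → ℤ, M.hv h (0, 0) = h c₀ := fun h => by
    simp [hv, hc₀, hc₀def]
  have hfaceH : ∀ f, M.C.faceH f = 0 := fun f => by rw [← hM]; rfl
  have hhf : ∀ (h : ↥M.freeCells → ℤ) (f : ℤ × ℤ), M.hf h f = 0 := fun h f => by
    have : (f, true) ∉ M.freeCells := by rw [hfree]; simp
    simp [hf, this, hfaceH]
  have hvalid : ∀ h : ↥M.freeCells → ℤ, M.IsValid h ↔ (h c₀ = 1 ∨ h c₀ = -1) := fun h => by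
    constructor
    · intro hval
      have := hval (0, 0) (by rw [hV]; simp) (0, 0) (by simp [SixVertex.vertexFaces])
        (by rw [hF]; simp) (Or.inl hc₀)
      rwa [hhv, hhf, sub_zero, abs_eq (by norm_num : (0 : ℤ) ≤ 1)] at this
    · intro hk x hx f _ _ _
      rw [hV, Finset.mem_singleton] at hx
      subst hx
      rw [hhv, hhf, sub_zero]
      exact (abs_eq (by norm_num : (0 : ℤ) ≤ 1)).mpr hk
  have hweight : ∀ h : ↥M.freeCells → ℤ, M.weight h = phase (h c₀) ^ 4 := fun h => by
    have hfw : ∀ e, M.frozenWeight h e = M.closedWeight h e := fun e => by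
      simp [frozenWeight, hopen]
    rw [weight, hE, Finset.prod_empty, one_mul, hfr]
    rw [Finset.prod_insert (by decide), Finset.prod_insert (by decide), Finset.prod_insert (by decide),
      Finset.prod_singleton]
    simp only [hfw, closedWeight, closedFactor, hV, hF, hhv, hhf, SixVertex.edgeTip, SixVertex.leftFace]
    norm_num [hhv]
    ring
  rw [Z]
  refine (Finset.sum_nbij' (fun h => h c₀) (fun k _ => k) (t := ({1, -1} : Finset ℤ))
    (g := fun k => phase k ^ 4) ?hi ?hj ?hli ?hri ?hw).trans ?hsum
  case hsum =>
    rw [Finset.sum_pair (by norm_num)]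
    exact phase_one_pow_four_add
  case hi =>
    intro h hh
    have hv := (Finset.mem_filter.mp hh).2
    rcases (hvalid h).mp hv with h1 | h1 <;> simp [h1]
  case hj =>
    intro k hk
    have hk' : k = 1 ∨ k = -1 := by simpa using hk
    refine Finset.mem_filter.mpr ⟨?_, (hvalid _).mpr hk'⟩
    refine Fintype.mem_piFinset.mpr fun _ => ?_
    have hB' : (2 : ℤ) ≤ (M.bound : ℤ) := by exact_mod_cast hB
    rcases hk' with rfl | rfl <;> simp only [Finset.mem_Icc] <;> omega
  case hli =>
    intro h _
    funext c
    rw [hsub c]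
  case hri =>
    intro k _
    rfl
  case hw =>
    intro h _
    exact hweight h

/-- `e^{iμj} e^{iμk} = e^{iμ(j+k)}`. [folklore] -/
theorem phase_mul_phase (j k : ℤ) : phase j * phase k = phase (j + k) := by
  simp only [phase, ← Complex.exp_add]
  congr 1
  push_cast
  ring

/-- `(e^{iμk})^n = e^{iμnk}`. [folklore] -/
theorem phase_pow (k : ℤ) (n : ℕ) : phase k ^ n = phase (n * k) := by
  simp only [phase, ← Complex.exp_nat_mul]
  congr 1
  push_cast
  ring

/-- `e^{6iμ} = e^{iπ/2} = i`. [folklore] -/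
theorem phase_six : phase 6 = Complex.I := by
  have : (((6 : ℤ) : ℝ) * (Real.pi / 12) : ℝ) = Real.pi / 2 := by push_cast; ring
  rw [phase, this, Complex.exp_mul_I]
  push_cast
  rw [Complex.cos_pi_div_two, Complex.sin_pi_div_two]
  ring

/-- `e^{-6iμ} = e^{-iπ/2} = -i`. [folklore] -/
theorem phase_neg_six : phase (-6) = -Complex.I := by
  have h0 : phase 0 = 1 := by simp [phase]
  have h := phase_mul_phase 6 (-6)
  rw [phase_six, show (6 : ℤ) + -6 = 0 by norm_num, h0] at h
  have hI : Complex.I * (-Complex.I) = 1 := by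
    rw [mul_neg, Complex.I_mul_I, neg_neg]
  calc phase (-6) = (Complex.I * (-Complex.I)) * phase (-6) := by rw [hI, one_mul]
    _ = -Complex.I * (Complex.I * phase (-6)) := by ring
    _ = -Complex.I := by rw [h, mul_one]

/-- **Sanity check `Z(2×1) = 2`**: two vertices joined by one live edge, four configurations
`(h₀, h₁) ∈ {±1}²`; the two c-type ones (`h₀ = h₁`) give `√3 (e^{iπ/2} + e^{-iπ/2}) = 0`, the two
others `1` each: `Z = 2 = 2^{|E|}`. [folklore] -/
theorem Z_2x1 : (ofDomain {((0 : ℤ), (0 : ℤ)), (1, 0)}).Z = 2 := by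
  have hfree : (ofDomain {((0 : ℤ), (0 : ℤ)), (1, 0)}).freeCells =
      {(((0 : ℤ), (0 : ℤ)), false), (((1 : ℤ), (0 : ℤ)), false)} := by decide
  have hE : (ofDomain {((0 : ℤ), (0 : ℤ)), (1, 0)}).E = {(((0 : ℤ), (0 : ℤ)), false)} := by decide
  have hfr : (ofDomain {((0 : ℤ), (0 : ℤ)), (1, 0)}).frozenEdges =
      {(((0 : ℤ), (0 : ℤ)), true), (((-1 : ℤ), (0 : ℤ)), false), (((0 : ℤ), (-1 : ℤ)), true),
        (((1 : ℤ), (0 : ℤ)), false), (((1 : ℤ), (0 : ℤ)), true), (((1 : ℤ), (-1 : ℤ)), true)} := by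
    decide
  have hopen : (ofDomain {((0 : ℤ), (0 : ℤ)), (1, 0)}).openEdges = ∅ := by decide
  have hV : (ofDomain {((0 : ℤ), (0 : ℤ)), (1, 0)}).vertexCells = {((0 : ℤ), (0 : ℤ)), (1, 0)} := by
    decide
  have hF : (ofDomain {((0 : ℤ), (0 : ℤ)), (1, 0)}).faceCells =
      {((0 : ℤ), (0 : ℤ)), (-1, 0), (0, -1), (-1, -1), (1, 0), (1, -1)} := by decide
  have hB : 2 ≤ (ofDomain {((0 : ℤ), (0 : ℤ)), (1, 0)}).bound := by
    unfold bound; exact Nat.le_add_left _ _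
  generalize hM : ofDomain {((0 : ℤ), (0 : ℤ)), (1, 0)} = M at hfree hE hfr hopen hV hF hB ⊢
  have hc₀ : (((0 : ℤ), (0 : ℤ)), false) ∈ M.freeCells := by rw [hfree]; decide
  have hc₁ : (((1 : ℤ), (0 : ℤ)), false) ∈ M.freeCells := by rw [hfree]; decide
  set c₀ : ↥M.freeCells := ⟨_, hc₀⟩ with hc₀def
  set c₁ : ↥M.freeCells := ⟨_, hc₁⟩ with hc₁def
  have hne : c₁ ≠ c₀ := by
    intro h
    have := congrArg (fun c : ↥M.freeCells => (c : (ℤ × ℤ) × Bool).1.1) h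
    simp [hc₀def, hc₁def] at this
  have hsub : ∀ c : ↥M.freeCells, c = c₀ ∨ c = c₁ := fun c => by
    have h2 : (c : (ℤ × ℤ) × Bool) ∈
        ({(((0 : ℤ), (0 : ℤ)), false), (((1 : ℤ), (0 : ℤ)), false)} : Finset ((ℤ × ℤ) × Bool)) :=
      hfree ▸ c.2
    rw [Finset.mem_insert, Finset.mem_singleton] at h2
    rcases h2 with h2 | h2
    · left; apply Subtype.ext; rw [hc₀def]; exact h2
    · right; apply Subtype.ext; rw [hc₁def]; exact h2
  have hhv0 : ∀ h : ↥M.freeCells → ℤ, M.hv h (0, 0) = h c₀ := fun h => by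
    simp [hv, hc₀, hc₀def]
  have hhv1 : ∀ h : ↥M.freeCells → ℤ, M.hv h (1, 0) = h c₁ := fun h => by
    simp [hv, hc₁, hc₁def]
  have hfaceH : ∀ f, M.C.faceH f = 0 := fun f => by rw [← hM]; rfl
  have hhf : ∀ (h : ↥M.freeCells → ℤ) (f : ℤ × ℤ), M.hf h f = 0 := fun h f => by
    have : (f, true) ∉ M.freeCells := by rw [hfree]; simp
    simp [hf, this, hfaceH]
  have hvalid : ∀ h : ↥M.freeCells → ℤ,
      M.IsValid h ↔ (h c₀ = 1 ∨ h c₀ = -1) ∧ (h c₁ = 1 ∨ h c₁ = -1) := fun h => by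
    constructor
    · intro hval
      have h0 := hval (0, 0) (by rw [hV]; simp) (0, 0) (by simp [SixVertex.vertexFaces])
        (by rw [hF]; simp) (Or.inl hc₀)
      have h1 := hval (1, 0) (by rw [hV]; simp) (1, 0) (by simp [SixVertex.vertexFaces])
        (by rw [hF]; simp) (Or.inl hc₁)
      rw [hhv0, hhf, sub_zero, abs_eq (by norm_num : (0 : ℤ) ≤ 1)] at h0
      rw [hhv1, hhf, sub_zero, abs_eq (by norm_num : (0 : ℤ) ≤ 1)] at h1
      exact ⟨h0, h1⟩
    · rintro ⟨hk0, hk1⟩ x hx f _ _ _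
      rw [hV, Finset.mem_insert, Finset.mem_singleton] at hx
      rcases hx with rfl | rfl
      · rw [hhv0, hhf, sub_zero]
        exact (abs_eq (by norm_num : (0 : ℤ) ≤ 1)).mpr hk0
      · rw [hhv1, hhf, sub_zero]
        exact (abs_eq (by norm_num : (0 : ℤ) ≤ 1)).mpr hk1
  have hweight : ∀ h : ↥M.freeCells → ℤ, M.weight h =
      (if h c₀ = h c₁ then ((Real.sqrt 3 : ℝ) : ℂ) else 1) * phase (h c₀) ^ 3 * phase (h c₁) ^ 3 :=
    fun h => by
    have hfw : ∀ e, M.frozenWeight h e = M.closedWeight h e := fun e => by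
      simp [frozenWeight, hopen]
    rw [weight, hE, Finset.prod_singleton, hfr]
    rw [Finset.prod_insert (by decide), Finset.prod_insert (by decide), Finset.prod_insert (by decide),
      Finset.prod_insert (by decide), Finset.prod_insert (by decide), Finset.prod_singleton]
    simp only [hfw, liveWeight, closedWeight, closedFactor, hV, hF, hhv0, hhv1, hhf, SixVertex.edgeTip,
      SixVertex.leftFace]
    norm_num [hhv0, hhv1]
    by_cases hab : h c₀ = h c₁
    · simp [hab]; ring
    · simp [hab]; ring
  rw [Z]
  refine (Finset.sum_nbij' (fun h => (h c₀, h c₁)) (fun p c => if c = c₀ then p.1 else p.2)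
    (t := ({1, -1} : Finset ℤ) ×ˢ ({1, -1} : Finset ℤ))
    (g := fun p => (if p.1 = p.2 then ((Real.sqrt 3 : ℝ) : ℂ) else 1) * phase p.1 ^ 3 * phase p.2 ^ 3)
    ?hi ?hj ?hli ?hri ?hw).trans ?hsum
  case hsum =>
    rw [Finset.sum_product, Finset.sum_pair (by norm_num), Finset.sum_pair (by norm_num),
      Finset.sum_pair (by norm_num)]
    simp only [phase_pow, mul_assoc, phase_mul_phase]
    norm_num
    have h0 : phase 0 = 1 := by simp [phase]
    rw [phase_six, phase_neg_six, h0]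
    ring
  case hi =>
    intro h hh
    have hv0 := (Finset.mem_filter.mp hh).2
    have hv := (hvalid h).mp hv0
    rw [Finset.mem_product]
    refine ⟨?_, ?_⟩ <;> dsimp only
    · rcases hv.1 with h0 | h0 <;> rw [h0] <;> decide
    · rcases hv.2 with h1 | h1 <;> rw [h1] <;> decide
  case hj =>
    intro p hp
    rw [Finset.mem_product] at hp
    have hp1 : p.1 = 1 ∨ p.1 = -1 := by simpa using hp.1
    have hp2 : p.2 = 1 ∨ p.2 = -1 := by simpa using hp.2
    refine Finset.mem_filter.mpr ⟨?_, (hvalid _).mpr ?_⟩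
    · refine Fintype.mem_piFinset.mpr fun c => ?_
      have hB' : (2 : ℤ) ≤ (M.bound : ℤ) := by exact_mod_cast hB
      by_cases hc : c = c₀
      · simp only [hc, if_true, Finset.mem_Icc]
        rcases hp1 with h1 | h1 <;> rw [h1] <;> omega
      · simp only [hc, if_false, Finset.mem_Icc]
        rcases hp2 with h2 | h2 <;> rw [h2] <;> omega
    · simpa [hne] using And.intro hp1 hp2
  case hli =>
    intro h _
    funext c
    rcases hsub c with rfl | rfl
    · simp
    · simp [hne]
  case hri =>
    intro p _
    simp [hne]
  case hw =>
    intro h _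
    exact hweight h

end Sanity

end Literature.Probability.LatticeModels.CollarLegModel
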